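import Summits.PneNP.PneNP.Theorems.KrwChromaticSteeringStrongCompositionChromaticEndgame

/-!
# Route KrwChromaticSteering, crux `StrongComposition` (stmt-PneNP-18538) — the crux IS the lever now

Bookkeeping file for the birth line of crux C1
`Summit.PneNP.PneNP.Theses.KrwChromaticSteering.StrongComposition`.  With both PRINTED stubs of the
registered skeleton landed as theorems — `stub_residualRectangle` (p547131) and `stub_chromaticEndgame`
(p547820) — the skeleton's composition `strongComposition_of_stubs` (p546030) makes the reduction of
the crux to the line's LEVER unconditional:

* `strongComposition_of_steeredTranscript : SteeredTranscript → StrongComposition` (the skeleton,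
  with its two printed stubs discharged);
* `steeredTranscript_of_strongComposition : StrongComposition → SteeredTranscript` (trivial: pad `π`
  to length `d` and use the chromatic disjunct — the refuter's observation in
  `Cruxes/StrongComposition/Disproof.lean` §3, restated here over the landed objects);
* `strongComposition_iff_steeredTranscript` — so the open crux item stmt-PneNP-18538 is now EXACTLY
  the steered structure theorem at `γ = 1` in dichotomy form (`SteeredTranscript`), kernel-checked.

Nothing is claimed about the lever itself (it is Meir's open problem in the line's coordinates);
nothing here bears on P vs NP.
-/

set_option linter.dupNamespace false -- `Summit.PneNP.PneNP.…`: summit = sub-problem name (D-0017 single-conjunct layout)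
set_option autoImplicit false

namespace Summit.PneNP.PneNP.Theorems.KrwStrongComposition

open Literature.Computability.Complexity

/-- **The lever implies the crux, unconditionally**: the registered skeleton's composition with its two
printed stubs (`stub_residualRectangle`, Meir 2023 §3.3; `stub_chromaticEndgame`, Meir 2023 Lemma 8)
discharged. [cite: Meir2023, §3.3, Lemma 8] -/
theorem strongComposition_of_steeredTranscript (h : SteeredTranscript) :
    Summit.PneNP.PneNP.Theses.KrwChromaticSteering.StrongComposition :=
  strongComposition_of_stubs stub_residualRectangle stub_chromaticEndgame h

/-- **The crux implies the lever, trivially**: given the `g` and the `KW_f` tree `Q` of strong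
composition for the family member `F g`, take `π` = `d` padding bits; the chromatic disjunct holds
because its right-hand side only grows with `log₂ log₂ χ(G_π)`.  (Refuter pnp-krw-ref-1's observation,
`Cruxes/StrongComposition/Disproof.lean` §3, over the landed objects.) [folklore] -/
theorem steeredTranscript_of_strongComposition
    (h : Summit.PneNP.PneNP.Theses.KrwChromaticSteering.StrongComposition) : SteeredTranscript := by
  obtain ⟨c, h⟩ := h
  refine ⟨c, fun m n hn f hf F d hF hd => ?_⟩
  obtain ⟨g, hg⟩ := h m n hn f hf
  obtain ⟨Q, hQ, hQd⟩ := hg (F g) (hF g)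
  refine ⟨List.replicate d false, by simp, Or.inr ⟨Q, hQ, ?_⟩⟩
  have hdg := hd g
  simp only [List.length_replicate]
  omega

/-- **Crux ≡ lever.**  The open crux `StrongComposition` (strong composition with `γ = 1`) is
equivalent to the steered structure theorem `SteeredTranscript` of the birth line — the item
stmt-PneNP-18538 is now exactly the lever, in Meir's structure-theorem coordinates (x-certificate:
a live residual label rectangle still `KW_f`-hard; y-certificate: `log₂ log₂ χ(G_π)`).
[cite: Meir2023, Thm. 3.2, §3.3, Lemma 8] -/
theorem strongComposition_iff_steeredTranscript :
    Summit.PneNP.PneNP.Theses.KrwChromaticSteering.StrongComposition ↔ SteeredTranscript :=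
  ⟨steeredTranscript_of_strongComposition, strongComposition_of_steeredTranscript⟩

end Summit.PneNP.PneNP.Theorems.KrwStrongComposition
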